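import Literature.AlgebraicGeometry.HodgeTheory.LefschetzDecompositionSingular
import Literature.AlgebraicGeometry.HodgeTheory.HodgeSectionRestrictionPairing
import Literature.AlgebraicGeometry.HodgeTheory.HardLefschetzHodgeRiemannOfAnisotropy
import Literature.AlgebraicGeometry.HodgeTheory.AlgebraicClassesPullbackDimLEThree
import Literature.AlgebraicGeometry.Motives.ComplexPointsManifold
import Literature.AlgebraicTopology.SingularHomology.CupProductProofs
import Summits.HodgeConjecture.HodgeConjecture.Theorems.Ring2AbelianAllSpreadBoxLefschetz
import HarnessLib

/-!
# Ring 2 · AbelianAll · SPREADING axis, part XIX — LEIBNIZ FOR THE BOX CLASS: PRIMITIVE ∪ PRIMITIVE IS PRIMITIVE (André 1996 §1.3's inclusion `P(X) ⊗ P(Y) ⊆ P(X × Y)`, fact-free)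

research route, not a corollary; conditional on HC_CM plus one named minimal statement.

Unit `pub-hodge-ring2-ab-spread-1` (ring 2, sub-cell AbelianAll, SPREADING axis), nineteenth file. THEOREMS ONLY: no
`def`, no node, no named fact, no displayed hypothesis, no `sorry`; `HC_CM` is not mentioned. This is the first
instalment of request R2′ of parts XVII/XVIII (the `𝔰𝔩₂`-equivariance of Künneth for the box class), in the
hard-Lefschetz-free form that the spreading floor actually needs.

## What is proved (`namespace Summit.HodgeConjecture.HodgeConjecture.Ring2.AbelianAll`)

On ONE topological space `Y` with coefficients in a commutative ring `R`, for two classes `α β ∈ H²(Y; R)` and the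
tree's Lefschetz iterates `lefschetzPowTo` (`HodgeTheory/HardLefschetzNFold`) and primitive submodules
`primitiveClasses κ n a = {x ∈ Hᵃ | (n < a → x = 0) ∧ L_κ^{n-a+1} x = 0}` (`HodgeTheory/LefschetzDecompositionSingular`,
Voisin I Def. 6.24):

* `lefschetzOperator_add_cupProduct` — the LEIBNIZ STEP `L_{α+β}(u ∪ v) = (L_α u) ∪ v + u ∪ (L_β v)` (cup product bilinear,
  associative, and graded-commutative with `deg β = 2` even: the tree's PROVED `cupProduct_gradedComm_holds`).
* `lefschetzPowTo_add_cupProduct_eq_zero` — NILPOTENCY ORDERS ADD: `L_α^s u = 0 ∧ L_β^t v = 0 ∧ s + t ≤ M + 1 ⟹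
  L_{α+β}^M (u ∪ v) = 0` (induction on `M` through the Leibniz step — no binomial coefficients are ever written).
* `cupProduct_mem_primitiveClasses_add` — **`P_α^i(n) ∪ P_β^j(n') ⊆ P_{α+β}^{i+j}(n + n')`** for ANY `α`, `β` (take
  `s = n + 1 - i`, `t = n' + 1 - j`).
* `mem_primitiveClasses_map` (pull-backs of primitive classes are primitive for the pulled-back class, by the tree's
  `map_lefschetzPowTo`), `cupProduct_map_mem_primitiveClasses` (the two-space form: `f^* x ∪ g^* y` is primitive for
  `f^* a + g^* b` in dimension `n + n'` when `x ∈ P_a^i(n)` on `X` and `y ∈ P_b^j(n')` on `X'`), `primitiveClasses_smul`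
  (`P_{t•κ} = P_κ` for `t ≠ 0`, by the tree's `lefschetzPowTo_smul`).
* `mem_primitiveClasses_of_degree_one` — on a smooth projective `n`-fold, `n ≥ 1`, EVERY class of degree `1` is primitive
  for every `κ` (`L^n w ∈ H^{2n+1} = 0`, the tree's `subsingleton_singularCohomology_of_lt`).
* **`exists_hardLefschetzNFold_prod_cupProduct_mem_primitiveClasses`** — for complex abelian varieties `A`, `B` of positive
  dimension there are hard-Lefschetz data `Λ_A`, `Λ_B`, `Λ` on `A`, `B`, `A × B` (part XVIII's box datum
  `exists_hardLefschetzNFold_prod_box`) such that `x ∈ P^i(A)`, `y ∈ P^j(B)` ⟹ `pr_A^* x ∪ pr_B^* y ∈ P^{i+j}(A × B)` — André's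
  "l'inclusion `Pⁱ(X) ⊗ Pʲ(Y) ⊂ P^{i+j}(X × Y)` fournie par cet isomorphisme est restriction de l'isomorphisme de Künneth"
  for the product polarisation, here WITHOUT Clebsch–Gordan: if `L_A^{g-i+1} x = 0` and `L_B^{m-j+1} y = 0` then every term of
  `L^{(g+m)-(i+j)+1}(x × y)` carries either `≥ g-i+1` copies of `h_A` on `x` or `≥ m-j+1` copies of `h_B` on `y` (pigeonhole),
  which the induction of `lefschetzPowTo_add_cupProduct_eq_zero` performs one copy at a time.

## Why (the spreading floor)

Part XVII showed `F_CM^{prim,ev} ⟹ F_CM^prim ⟹ F_CM` modulo the displayed primitive-lift shape `(PL)`; part XVIII supplied the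
box hard-Lefschetz datum (R1′). The remaining request R2′ asked for the `𝔰𝔩₂ ⊗ 𝔰𝔩₂` bookkeeping. This file is its
multiplicative half and opens a CHEAPER line to the lift than `(PL)` as displayed (recorded in the seat's SPREAD.md §36, not
claimed here): lifting along the `N`-fold DIAGONAL `A → A^N` instead of `(𝟙, 0) : A → A × B` — external products of
degree-one classes are primitive for the box class by the theorems below, `dim A^N = N·g` is even for `N = 2p`, and part
XVII §1's `IsCMAnchoredDatumFor.comap` pulls anchored data back along any homomorphism. Nothing of that line beyond the
present algebraic-topology lemmas is proved here.

## Honest column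

Nothing here proves `HC_AV`, `HC_CM`, `CMToAbelian`, any floor node, or `(PL)`; no case of the Hodge conjecture is proved;
`HC_CM` is not mentioned; no row of part XVII loses its `(PL)` binder; **B_min of record UNCHANGED** (least typed node
`F_CM^{prim,ev}`, N103); "minimal" and "strictly smaller than `F_CM`" are claimed for nothing. Parts VII, XIV–XVIII untouched.
[cite: Andre1996Motifs, §1.3 (p. 12)] [cite: VoisinHodgeI2002, §6.2.3 Def. 6.24, Lemma 6.21 and Thm. 6.25]
[cite: HatcherAT2002, §3.2 Prop. 3.10 and Thm. 3.11]
-/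

noncomputable section

set_option linter.dupNamespace false

open CategoryTheory
open Literature.AlgebraicTopology.SingularHomology Literature.Geometry.Kaehler
open Literature.AlgebraicGeometry Literature.AlgebraicGeometry.HodgeTheory Literature.AlgebraicGeometry.Motives

namespace Summit.HodgeConjecture.HodgeConjecture.Ring2.AbelianAll

universe u v

section SingleSpace

variable {Y : Type u} [TopologicalSpace Y] {R : Type v} [CommRing R]

/-- **Leibniz step for a sum of degree-two classes**: `L_{α+β}(u ∪ v) = (L_α u) ∪ v + u ∪ (L_β v)` — bilinearity and
associativity of the cup product, and graded commutativity `β ∪ u = u ∪ β` (`deg β = 2`).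
[cite: HatcherAT2002, §3.2 Prop. 3.10 and Thm. 3.11] [cite: VoisinHodgeI2002, §6.2.3 Lemma 6.21] -/
theorem lefschetzOperator_add_cupProduct (α β : singularCohomology R R Y 2) {i j k l : ℕ} (hk : i + j = k)
    (hl : 2 + k = l) (u : singularCohomology R R Y i) (v : singularCohomology R R Y j) :
    lefschetzOperator (α + β) hl (cupProduct hk u v) =
      cupProduct (show 2 + i + j = l by omega) (lefschetzOperator α rfl u) v +
        cupProduct (show i + (2 + j) = l by omega) u (lefschetzOperator β rfl v) := by
  simp only [lefschetzOperator_apply, LinearMap.map_add, LinearMap.add_apply]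
  congr 1
  · exact (cupProduct_assoc (rfl : 2 + i = 2 + i) hk (show 2 + i + j = l by omega) hl α u v).symm
  · rw [← cupProduct_assoc (rfl : 2 + i = 2 + i) hk (show 2 + i + j = l by omega) hl β u v,
      cupProduct_gradedComm_holds R Y (rfl : 2 + i = 2 + i) (show i + 2 = 2 + i by omega) β u,
      show ((-1 : R) ^ (2 * i)) = 1 by rw [pow_mul, neg_one_sq, one_pow], one_smul,
      cupProduct_assoc (show i + 2 = 2 + i by omega) (rfl : 2 + j = 2 + j) (show 2 + i + j = l by omega)
        (show i + (2 + j) = l by omega) u β v]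

/-- **Nilpotency orders add along a cup product**: if `L_α^s u = 0` and `L_β^t v = 0` then `L_{α+β}^M (u ∪ v) = 0` as soon
as `s + t ≤ M + 1` (induction on `M` through the Leibniz step; the binomial expansion
`L_{α+β}^M(u ∪ v) = Σ (M choose a) L_α^a u ∪ L_β^{M-a} v` is never written). Target degrees are explicit throughout.
[cite: VoisinHodgeI2002, §6.2.3 Lemma 6.21] [cite: Andre1996Motifs, §1.3 (p. 12)] -/
theorem lefschetzPowTo_add_cupProduct_eq_zero (α β : singularCohomology R R Y 2) :
    ∀ (M : ℕ) {i j k m : ℕ} (hk : i + j = k) (hm : k + 2 * M = m) (u : singularCohomology R R Y i)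
      (v : singularCohomology R R Y j) (s t : ℕ),
      (∀ (m₁ : ℕ) (h₁ : i + 2 * s = m₁), lefschetzPowTo α s i m₁ h₁ u = 0) →
      (∀ (m₂ : ℕ) (h₂ : j + 2 * t = m₂), lefschetzPowTo β t j m₂ h₂ v = 0) →
      s + t ≤ M + 1 → lefschetzPowTo (α + β) M k m hm (cupProduct hk u v) = 0 := by
  intro M
  induction M with
  | zero =>
    intro i j k m hk hm u v s t hu hv hst
    obtain rfl : k = m := by omega
    rw [lefschetzPowTo_zero_eq_id, LinearMap.id_apply]
    rcases Nat.eq_zero_or_pos s with rfl | hs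
    · have hu0 : u = 0 := by simpa using hu i rfl
      simp [hu0]
    · obtain rfl : t = 0 := by omega
      have hv0 : v = 0 := by simpa using hv j rfl
      simp [hv0]
  | succ M ih =>
    intro i j k m hk hm u v s t hu hv hst
    rw [← lefschetzPowTo_lefschetzOperator (α + β) M (rfl : 2 + k = 2 + k) (show 2 + k + 2 * M = m by omega) hm,
      lefschetzOperator_add_cupProduct α β hk rfl u v, LinearMap.map_add]
    refine (congrArg₂ (· + ·) ?_ ?_).trans (add_zero _)
    · rcases Nat.eq_zero_or_pos s with rfl | hs
      · have hu0 : u = 0 := by simpa using hu i rfl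
        simp [hu0]
      · obtain ⟨s', rfl⟩ : ∃ s', s = s' + 1 := ⟨s - 1, by omega⟩
        refine ih _ _ _ v s' t (fun m₁ h₁ ↦ ?_) hv (by omega)
        rw [lefschetzPowTo_lefschetzOperator α s' rfl h₁ (by omega) u]
        exact hu m₁ _
    · rcases Nat.eq_zero_or_pos t with rfl | hs
      · have hv0 : v = 0 := by simpa using hv j rfl
        simp [hv0]
      · obtain ⟨t', rfl⟩ : ∃ t', t = t' + 1 := ⟨t - 1, by omega⟩
        refine ih _ _ u _ s t' hu (fun m₂ h₂ ↦ ?_) (by omega)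
        rw [lefschetzPowTo_lefschetzOperator β t' rfl h₂ (by omega) v]
        exact hv m₂ _

/-- **Primitive ∪ primitive is primitive for the sum class**: `u ∈ P_α^i(n)`, `v ∈ P_β^j(n')` ⟹
`u ∪ v ∈ P_{α+β}^{i+j}(n + n')`, for ANY classes `α β ∈ H²(Y; R)` on one space (the two-space form below is the one
with content). [cite: Andre1996Motifs, §1.3 (p. 12)] [cite: VoisinHodgeI2002, §6.2.3 Def. 6.24] -/
theorem cupProduct_mem_primitiveClasses_add (α β : singularCohomology R R Y 2) (n n' : ℕ) {i j k : ℕ}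
    (hk : i + j = k) {u : singularCohomology R R Y i} {v : singularCohomology R R Y j}
    (hu : u ∈ primitiveClasses α n i) (hv : v ∈ primitiveClasses β n' j) :
    cupProduct hk u v ∈ primitiveClasses (α + β) (n + n') k := by
  by_cases hi : n < i
  · rw [hu.1 hi, LinearMap.map_zero, LinearMap.zero_apply]
    exact Submodule.zero_mem _
  by_cases hj : n' < j
  · rw [hv.1 hj, LinearMap.map_zero]
    exact Submodule.zero_mem _
  simp only [not_lt] at hi hj
  refine ⟨fun h ↦ absurd h (by omega), fun r m h hr ↦ ?_⟩
  exact lefschetzPowTo_add_cupProduct_eq_zero α β r hk h u v (n + 1 - i) (n' + 1 - j)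
    (fun m₁ h₁ ↦ hu.2 _ m₁ h₁ (by omega)) (fun m₂ h₂ ↦ hv.2 _ m₂ h₂ (by omega)) (by omega)

/-- `P_{t • κ} = P_κ` for a unit scalar `t ≠ 0` (over `ℂ`): `L_{t•κ}^r = t^r L_κ^r` (the tree's `lefschetzPowTo_smul`).
[cite: VoisinHodgeI2002, §6.2.3 Def. 6.24] -/
theorem primitiveClasses_smul {Y : Type u} [TopologicalSpace Y] (κ : singularCohomology ℂ ℂ Y 2) (n a : ℕ)
    {t : ℂ} (ht : t ≠ 0) : primitiveClasses (t • κ) n a = primitiveClasses κ n a := by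
  ext x
  refine ⟨fun hx ↦ ⟨hx.1, fun r m h hr ↦ ?_⟩, fun hx ↦ ⟨hx.1, fun r m h hr ↦ ?_⟩⟩
  · have h0 := hx.2 r m h hr
    rw [lefschetzPowTo_smul] at h0
    exact (smul_eq_zero.1 h0).resolve_left (pow_ne_zero r ht)
  · rw [lefschetzPowTo_smul, hx.2 r m h hr, smul_zero]

end SingleSpace

section TwoSpaces

variable {X X' Z : Motives.SchemeOver ℂ}

/-- Pull-backs of primitive classes are primitive for the pulled-back class (same formal dimension):
`x ∈ P_a^i(n)` on `X` ⟹ `f^* x ∈ P_{f^*a}^i(n)` on `Z` (the tree's `map_lefschetzPowTo`).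
[cite: VoisinHodgeI2002, §6.2.3 and §7.3.2] -/
theorem mem_primitiveClasses_map (f : Z ⟶ X) (a : complexBetti X 2) (n : ℕ) {i : ℕ} {x : complexBetti X i}
    (hx : x ∈ primitiveClasses a n i) :
    complexBetti.map f i x ∈ primitiveClasses (complexBetti.map f 2 a) n i :=
  ⟨fun h ↦ by rw [hx.1 h, map_zero],
    fun r m h hr ↦ by rw [← map_lefschetzPowTo f a r i m h x, hx.2 r m h hr, map_zero]⟩

/-- **The two-space form**: `x ∈ P_a^i(n)` on `X`, `y ∈ P_b^j(n')` on `X'`, `f : Z ⟶ X`, `g : Z ⟶ X'` ⟹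
`f^* x ∪ g^* y ∈ P_{f^*a + g^*b}^{i+j}(n + n')` on `Z`. With `Z = X × X'`, `f`, `g` the projections and `a`, `b` hyperplane
classes this is André's inclusion `Pⁱ(X) ⊗ Pʲ(X') ⊆ P^{i+j}(X × X')` for the product polarisation.
[cite: Andre1996Motifs, §1.3 (p. 12)] -/
theorem cupProduct_map_mem_primitiveClasses (f : Z ⟶ X) (g : Z ⟶ X') (a : complexBetti X 2)
    (b : complexBetti X' 2) (n n' : ℕ) {i j k : ℕ} (hk : i + j = k) {x : complexBetti X i} {y : complexBetti X' j}
    (hx : x ∈ primitiveClasses a n i) (hy : y ∈ primitiveClasses b n' j) :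
    cupProduct hk (complexBetti.map f i x) (complexBetti.map g j y) ∈
      primitiveClasses (complexBetti.map f 2 a + complexBetti.map g 2 b) (n + n') k :=
  cupProduct_mem_primitiveClasses_add _ _ n n' hk (mem_primitiveClasses_map f a n hx)
    (mem_primitiveClasses_map g b n' hy)

/-- On a smooth projective `n`-fold with `n ≥ 1`, EVERY degree-one class is primitive for every `κ ∈ H²`:
`L_κ^n w ∈ H^{2n+1}(X(ℂ); ℂ) = 0`. [cite: VoisinHodgeI2002, §6.2.3 Def. 6.24] [cite: HatcherAT2002, §3.3 Thm. 3.26] -/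
theorem mem_primitiveClasses_of_degree_one {n : ℕ} (hX : IsSmoothProjective n X) (hn : 1 ≤ n)
    (κ : complexBetti X 2) (w : complexBetti X 1) : w ∈ primitiveClasses κ n 1 := by
  refine ⟨fun h ↦ absurd h (by omega), fun r m h hr ↦ ?_⟩
  haveI := Motives.ComplexPoints.subsingleton_singularCohomology_of_lt hX ℂ (k := m) (by omega)
  exact Subsingleton.elim _ _

end TwoSpaces

/-! ### On a product of abelian varieties, with part XVIII's box datum -/

/-- **André 1996 §1.3 for complex abelian varieties, fact-free**: for `A`, `B` of positive dimension there are
hard-Lefschetz data `Λ_A`, `Λ_B` on the factors and `Λ` on `A × B` (part XVIII: the classes are non-zero multiples of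
`h_A`, `h_B`, `pr_A^* h_A + pr_B^* h_B`) such that `x ∈ P^i_{Λ_A}(A)`, `y ∈ P^j_{Λ_B}(B)` ⟹
`pr_A^* x ∪ pr_B^* y ∈ P^{i+j}_Λ(A × B)` (`dim (A × B) = dim A + dim B`). [cite: Andre1996Motifs, §1.3 (p. 12)]
[cite: VoisinHodgeI2002, Thm. 6.25 and §6.2.3 Def. 6.24] -/
theorem exists_hardLefschetzNFold_prod_cupProduct_mem_primitiveClasses (A B : AbelianVariety ℂ)
    (hA : 1 ≤ A.dim) (hB : 1 ≤ B.dim) :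
    ∃ (ΛA : HardLefschetzNFold A.dim A.X) (ΛB : HardLefschetzNFold B.dim B.X)
      (Λ : HardLefschetzNFold (A.prod B).dim (A.prod B).X),
      ∀ (i j k : ℕ) (hk : i + j = k) (x : complexBetti A.X i) (y : complexBetti B.X j),
        x ∈ primitiveClasses ΛA.hyperplaneClass A.dim i → y ∈ primitiveClasses ΛB.hyperplaneClass B.dim j →
          cupProduct hk (complexBetti.map (AbelianVariety.fst A B).hom.hom.hom i x)
              (complexBetti.map (AbelianVariety.snd A B).hom.hom.hom j y) ∈
            primitiveClasses Λ.hyperplaneClass (A.prod B).dim k := by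
  obtain ⟨hA', hB', -, -, ⟨ΛA, a, ha, hΛA⟩, ⟨ΛB, b, hb, hΛB⟩, Λ, t, ht, hΛ⟩ :=
    exists_hardLefschetzNFold_prod_box A B hA hB
  refine ⟨ΛA, ΛB, Λ, fun i j k hk x y hx hy ↦ ?_⟩
  rw [hΛA, primitiveClasses_smul _ _ _ ha] at hx
  rw [hΛB, primitiveClasses_smul _ _ _ hb] at hy
  rw [hΛ, primitiveClasses_smul _ _ _ ht, AbelianVariety.dim_prod]
  exact cupProduct_map_mem_primitiveClasses _ _ hA' hB' A.dim B.dim hk hx hy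

end Summit.HodgeConjecture.HodgeConjecture.Ring2.AbelianAll

end
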